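import Mathlib
import HarnessLib
import Summits.NavierStokesRegularity.NavierStokesRegularity.Theorems.PoloidalWindowDoorPoloidalWindowRigidityLinearNonrigidity

/-!
# Route `PoloidalWindowDoor` (staged, nsreg-p1), crux `PoloidalWindowRigidity` (K2) — the non-rigid linear mode at
# `U♭` is a PURE AZIMUTHAL MODE 3: `𝓛(𝓛W) = −9W` (companion of `…PoloidalWindowRigidityLinearNonrigidity`)

Cell ns-regularity-ideate, seat p7 (lead on K2). With nsreg-p1's rotation generator `𝓛 = rotGen`
(`rotGen v x = Dv(x)[e₂ × x] − e₂ × v(x)`, R9-PREP §(2) / `Sketch9.lean`), the kernel-certified solution `W`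
(`modeW`) of the poloidal system linearised at `U♭` satisfies `rotGen (rotGen W) = −9 W` on `ℝ³`
(`rotGen_rotGen_modeW`) while `rotGen U♭ = 0` (`rotGen_uFlat`): in the language of nsreg-p1's conjecture S9
(`LandauPoloidalModeRigidity`: pure modes `m ≥ 2` of the linearised poloidal system vanish), the statement with the
Landau base replaced by `U♭` is FALSE for `m = 3` (R9-PREP §7.2, `h₃(U♭) = 1`), by an exact kernel computation
over `ℚ` (`decide +kernel`; term lists `rotGenQ`).

WHAT THIS IS NOT: not a claim about Navier–Stokes regularity, not a refutation of S9 (which is about the Landau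
base) nor of K2 — kernel bookkeeping for a STAGED door route's open stub (bears_on LADDER-NS N0, rung
N0-LocalTubeDoorPoloidal).
-/

noncomputable section

-- the summit and its single sub-problem share the name (CONVENTIONS §1), as in every Theorems file
set_option linter.dupNamespace false

namespace Summit.NavierStokesRegularity.NavierStokesRegularity.Theorems.PoloidalWindowDoorPoloidalWindowRigidityLinearNonrigidityMode

open scoped RealInnerProductSpace InnerProductSpace ContDiff Laplacian
open Literature.Analysis Literature.Analysis.FluidPDE
open Literature.Analysis.Calculus.MvPoly
open Literature.Analysis.ValidatedNumerics Literature.Analysis.ValidatedNumerics.QMvPoly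
open Literature.Analysis.FluidPDE.PolyFieldCert
open Summit.NavierStokesRegularity.NavierStokesRegularity.Theorems.PoloidalWindowDoorPoloidalWindowRigidityLinearNonrigidity

/-! ### `W` is a pure azimuthal mode `3`: `𝓛(𝓛 W) = −9 W` (nsreg-p1 S9's normal form) -/

/-- The generator of rotations about `e₂` acting on vector fields (nsreg-p1 R9-PREP §(2), `Sketch9.rotGen`):
`rotGen v x = Dv(x)[e₂ × x] − e₂ × v(x)`; `rotGen v = 0` iff `v` is infinitesimally axisymmetric, and a pure
azimuthal mode `m` satisfies `rotGen (rotGen v) = −m² v`. -/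
def rotGen (v : EuclideanSpace ℝ (Fin 3) → EuclideanSpace ℝ (Fin 3)) (x : EuclideanSpace ℝ (Fin 3)) :
    EuclideanSpace ℝ (Fin 3) :=
  fderiv ℝ v x (cross (EuclideanSpace.single 2 1) x) - cross (EuclideanSpace.single 2 1) (v x)

/-- Term lists of `rotGen` of a polynomial field: `(rotGen V)ᵢ = −x₁∂₀Vᵢ + x₀∂₁Vᵢ − (e₂ × V)ᵢ`,
`e₂ × V = (−V₁, V₀, 0)`. -/
def rotGenQ (V : Fin 3 → QMvPoly) : Fin 3 → QMvPoly :=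
  ![mul (smul (-1) (var 3 1)) (pderivQ 0 (V 0)) ++ (mul (var 3 0) (pderivQ 1 (V 0)) ++ V 1),
    mul (smul (-1) (var 3 1)) (pderivQ 0 (V 1)) ++ (mul (var 3 0) (pderivQ 1 (V 1)) ++ smul (-1) (V 0)),
    mul (smul (-1) (var 3 1)) (pderivQ 0 (V 2)) ++ mul (var 3 0) (pderivQ 1 (V 2))]

/-- `∂₀` on term lists (with `toMv` spelled out, for `simp`). -/
theorem toMv_pderivQ_zero (p : QMvPoly) : toMv ℝ 3 (pderivQ 0 p) = MvPolynomial.pderiv 0 (toMv ℝ 3 p) :=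
  toMv_pderivQ ℝ 3 (0 : Fin 3) p

/-- `∂₁` on term lists (with `toMv` spelled out, for `simp`). -/
theorem toMv_pderivQ_one (p : QMvPoly) : toMv ℝ 3 (pderivQ 1 p) = MvPolynomial.pderiv 1 (toMv ℝ 3 p) :=
  toMv_pderivQ ℝ 3 (1 : Fin 3) p

/-- `x₀` as a term-list polynomial. -/
theorem toFun_var_zero (x : EuclideanSpace ℝ (Fin 3)) : toFun (toMv ℝ 3 (var 3 0)) x = x 0 :=
  (congrArg (fun r => toFun r x) (toMv_var ℝ 3 (0 : Fin 3))).trans (toFun_X 0 x)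

/-- `x₁` as a term-list polynomial. -/
theorem toFun_var_one (x : EuclideanSpace ℝ (Fin 3)) : toFun (toMv ℝ 3 (var 3 1)) x = x 1 :=
  (congrArg (fun r => toFun r x) (toMv_var ℝ 3 (1 : Fin 3))).trans (toFun_X 1 x)

/-- `e₂ × y = (−y₁, y₀, 0)` componentwise. -/
theorem cross_single_two_apply (y : EuclideanSpace ℝ (Fin 3)) :
    cross (EuclideanSpace.single 2 1) y 0 = -y 1 ∧ cross (EuclideanSpace.single 2 1) y 1 = y 0 ∧
      cross (EuclideanSpace.single 2 1) y 2 = 0 := by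
  refine ⟨?_, ?_, ?_⟩ <;> simp [cross, cross_apply]

/-- Semantics of `rotGenQ`, component `0`. -/
theorem toFun_rotGenQ_zero (V : Fin 3 → QMvPoly) (x : EuclideanSpace ℝ (Fin 3)) :
    toFun (mv (rotGenQ V 0)) x = -x 1 * toFun (MvPolynomial.pderiv 0 (mv (V 0))) x +
      x 0 * toFun (MvPolynomial.pderiv 1 (mv (V 0))) x + toFun (mv (V 1)) x := by
  simp only [rotGenQ, Matrix.cons_val_zero, mv, toMv_append, toMv_mul, toMv_smul, toMv_pderivQ_zero,
    toMv_pderivQ_one, toFun_add, toFun_mul, toFun_smul, toFun_var_zero, toFun_var_one]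
  push_cast
  ring

/-- Semantics of `rotGenQ`, component `1`. -/
theorem toFun_rotGenQ_one (V : Fin 3 → QMvPoly) (x : EuclideanSpace ℝ (Fin 3)) :
    toFun (mv (rotGenQ V 1)) x = -x 1 * toFun (MvPolynomial.pderiv 0 (mv (V 1))) x +
      x 0 * toFun (MvPolynomial.pderiv 1 (mv (V 1))) x - toFun (mv (V 0)) x := by
  simp only [rotGenQ, Matrix.cons_val_one, Matrix.cons_val_zero, mv, toMv_append, toMv_mul, toMv_smul,
    toMv_pderivQ_zero, toMv_pderivQ_one, toFun_add, toFun_mul, toFun_smul, toFun_var_zero, toFun_var_one]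
  push_cast
  ring

/-- Semantics of `rotGenQ`, component `2`. -/
theorem toFun_rotGenQ_two (V : Fin 3 → QMvPoly) (x : EuclideanSpace ℝ (Fin 3)) :
    toFun (mv (rotGenQ V 2)) x = -x 1 * toFun (MvPolynomial.pderiv 0 (mv (V 2))) x +
      x 0 * toFun (MvPolynomial.pderiv 1 (mv (V 2))) x := by
  simp only [rotGenQ, Matrix.cons_val_two, Matrix.tail_cons, Matrix.head_cons, mv, toMv_append, toMv_mul,
    toMv_smul, toMv_pderivQ_zero, toMv_pderivQ_one, toFun_add, toFun_mul, toFun_smul, toFun_var_zero,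
    toFun_var_one]
  push_cast
  ring

/-- **`rotGen` of a term-list field is the term-list field `rotGenQ`.** -/
theorem rotGen_qField (V : Fin 3 → QMvPoly) (x : EuclideanSpace ℝ (Fin 3)) :
    rotGen (qField V) x = qField (rotGenQ V) x := by
  obtain ⟨c0, c1, c2⟩ := cross_single_two_apply x
  obtain ⟨d0, d1, d2⟩ := cross_single_two_apply (qField V x)
  have hD : ∀ i : Fin 3, fderiv ℝ (qField V) x (cross (EuclideanSpace.single 2 1) x) i =
      -x 1 * toFun (MvPolynomial.pderiv 0 (mv (V i))) x + x 0 * toFun (MvPolynomial.pderiv 1 (mv (V i))) x := by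
    intro i
    rw [qField, fderiv_polyField_apply, Fin.sum_univ_three, c0, c1, c2]
    ring
  ext i
  fin_cases i
  · show rotGen (qField V) x 0 = qField (rotGenQ V) x 0
    rw [rotGen, PiLp.sub_apply, hD, d0, qField, polyField_apply, qField, polyField_apply, toFun_rotGenQ_zero]
    ring
  · show rotGen (qField V) x 1 = qField (rotGenQ V) x 1
    rw [rotGen, PiLp.sub_apply, hD, d1, qField, polyField_apply, qField, polyField_apply, toFun_rotGenQ_one]
  · show rotGen (qField V) x 2 = qField (rotGenQ V) x 2
    rw [rotGen, PiLp.sub_apply, hD, d2, qField, polyField_apply, toFun_rotGenQ_two, sub_zero]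

/-- Certificate: `rotGenQ (rotGenQ W) + 9 W` normalises to zero. -/
theorem cert_rotGen_wQ : ∀ i : Fin 3, normalize (rotGenQ (rotGenQ wQ) i ++ smul 9 (wQ i)) = [] := by
  decide +kernel

/-- Certificate: `rotGenQ U♭` normalises to zero (infinitesimal axisymmetry of the base). -/
theorem cert_rotGen_uQ : ∀ i : Fin 3, normalize (rotGenQ uQ i) = [] := by decide +kernel

/-- **`W` is a pure azimuthal mode `3`**: `rotGen (rotGen W) = −9 W` on `ℝ³` — exactly the mode hypothesis
`𝓛(𝓛w) = −m²w`, `m = 3 ≥ 2`, of nsreg-p1's S9 `LandauPoloidalModeRigidity`, which therefore FAILS when the Landau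
base is replaced by `U♭` (R9-PREP §7.2: `h₃(U♭) = 1`). -/
theorem rotGen_rotGen_modeW (x : EuclideanSpace ℝ (Fin 3)) : rotGen (rotGen modeW) x = (-9 : ℝ) • modeW x := by
  have h1 : rotGen modeW = qField (rotGenQ wQ) := funext fun y => rotGen_qField wQ y
  rw [h1, rotGen_qField]
  ext i
  have key := congrArg (fun r => toFun r x) (mv_eq_zero_of_normalize (cert_rotGen_wQ i))
  simp only [mv, toMv_append, toMv_smul, toFun_add, toFun_smul, toFun_zero] at key
  push_cast at key
  rw [qField, polyField_apply, PiLp.smul_apply, smul_eq_mul, modeW, qField, polyField_apply]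
  simp only [mv]
  linarith

/-- `rotGen U♭ = 0`: the base is (infinitesimally) axisymmetric, consistent with `isAxisymmetric_uFlat`. -/
theorem rotGen_uFlat (x : EuclideanSpace ℝ (Fin 3)) : rotGen uFlat x = 0 := by
  rw [uFlat, rotGen_qField]
  ext i
  have key := congrArg (fun r => toFun r x) (mv_eq_zero_of_normalize (cert_rotGen_uQ i))
  rw [toFun_zero] at key
  rw [qField, polyField_apply, key]
  rfl

end Summit.NavierStokesRegularity.NavierStokesRegularity.Theorems.PoloidalWindowDoorPoloidalWindowRigidityLinearNonrigidityMode

end
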